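import Mathlib
import HarnessLib
import Summits.HubbardSuperconductivity.HubbardSuperconductivity.Theorems.KLProgrammeKLRegimeEnginePairTransferDLineEdgePinnedFiveSlotL
import Summits.HubbardSuperconductivity.HubbardSuperconductivity.Theorems.KLProgrammeKLRegimeEnginePairTransferDLineEdgePinnedFiveSlotTC

/-!
# Route `KLProgramme` — ENGINE item stmt-HubbardSuperconductivity-20437 `KLRegimeEngineV17F2`, class #5 rev 3 — «88b» THE PINNED PAIR: the five-slot ADAPTER WITH THE L-ROW on the
# `TC` family — `dLine_pinned_direct_fiveSlotTCL`, `dLine_pinned_crossed_fiveSlotTCL`; + §0 the L-ROW with a SCALE-FREE Lipschitz datum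
# (`klpl_lattice_row_le_overlap_scaled` / `_thermal_scaled`: `L_A·Λ_m ≤ l` for some `m ≤ n_β+1` ⇒ coefficient `(l + A₀GC)·U/(2^48 Psq²Rsq²)`, for cell doors with one global `Lg ∝ 4^m`)
# (cell gate-hubbard-kl, seat hubbard-kl-k3c1-p1 g22; located «(X).3-PINNED-LATTICE-SLOT»; twin of …DLineEdgePinnedFiveSlotL §1 on k3c2-p2 g23's `…fiveSlotTC'`)

WHY.  As in …DLineEdgePinnedFiveSlotL: the `TC`-family adapters of record (…DLineEdgePinnedFiveSlotTC (`dLine_pinned_*_fiveSlotTC'`, k3c2-p2 g23)) book the forward lattice entry `2·LAT⋆ₙ/L`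
(`LAT⋆ₙ = 96(512L₁/Λₙ₊₁ + 32A₀G·C/Λₙ₊₁²)`, TC numeral `C = (9(2(448/3)e² + 8) + 32) + (3·128 + 512)`) in `hl : 2·LAT⋆ₙ/L + A₂·1024·15381/L ≤ (KlamU)²·l/L`, where `L` cancels and
`LAT⋆ₙ ∝ 16ⁿ` meets the n-flat binder `l` of (T4p-L) — unsatisfiable uniformly in the depth.  THIS FILE re-proves the two `TC` adapters with the L-ROW
`klpl_lattice_row_le_overlap` (`klEngL₄ P R β U ≤ L`, `n ≤ n_β`, `0 < U` ⇒ `2·LAT⋆ₙ/L ≤ (L₁ + A₀GC)·U/(2^52·klEngPsq P²·klEngRsq R²)·4^{−(n+1)}`):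
SAME conclusions (the spine's guarded five-slot rows verbatim; «95v2» untouched), SAME binders plus `0 < U`, `klEngL₄ P R β U ≤ L`, size rows `hh hw htt` verbatim,
`hz` with the added n-flat lattice coefficient on its left, `hl : A₂·1024·15381 ≤ (KlamU)²·l` (`L`-free).  The flatness row `hw` and the window term of `hz` are the
located «COOPER-ANTIPODE» pairings and move with k3c2-p2's cell-data doors (cure (A″)), not here.  Pure composition + real arithmetic over landed rows; nothing about
the model's sizes is asserted; nothing asserts (X).3, (c), K3 or superconductivity.  0 kit · 0 lit.
References: BGM 2006 §2.3 (2.21)–(2.24) [cite: BenfattoGiulianiMastropietro2006].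
-/

noncomputable section

namespace Summit.HubbardSuperconductivity.HubbardSuperconductivity.Theorems.KLRegimeSplit

set_option linter.dupNamespace false -- summit = problem name (single-conjunct summit), D-0017

open Real Set Finset Complex Literature.MathematicalPhysics.QuantumLattice
open Literature.Probability.LatticeModels hiding torusSupNorm
open Literature.MathematicalPhysics.QuantumLattice.BandSectorCounting
open Summit.HubbardSuperconductivity.HubbardSuperconductivity.Theorems.KLProgrammeLegKernels
open Summit.HubbardSuperconductivity.HubbardSuperconductivity.Theorems.KLRegimeWick
open Summit.HubbardSuperconductivity.HubbardSuperconductivity.Theorems.TwoPointAssembly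
open Summit.HubbardSuperconductivity.HubbardSuperconductivity.Theorems.DispersionFlow
open Summit.HubbardSuperconductivity.HubbardSuperconductivity.Theorems.PerturbedFermiCurve
open Summit.HubbardSuperconductivity.HubbardSuperconductivity.Theorems.EngineV8

section LRowScaled

/-! ## §0 The L-ROW with a SCALE-FREE Lipschitz datum (for doors whose lattice→continuum step carries a GLOBAL Lipschitz constant growing like `4^m`) -/

/-- `4^m ≤ β/24` for every `m ≤ n_β + 1` (`klpl_four_pow_succ_le` at `n_β`). -/
theorem klpl_four_pow_le_of_le_succ {β : ℝ} (hβ : klBetaMin ≤ β) {m : ℕ} (hm : m ≤ nScales β + 1) : (4 : ℝ) ^ m ≤ β / 24 :=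
  (pow_le_pow_right₀ (by norm_num : (1 : ℝ) ≤ 4) hm).trans (klpl_four_pow_succ_le hβ le_rfl)

/-- A SCALE-FREE Lipschitz datum `L_A·Λ_m ≤ l` (`m ≤ n_β + 1`) gives `L_A ≤ (4/3)·l·β` (`1/Λ_m = 32·4^m ≤ 32β/24`). -/
theorem klpl_lip_le_of_scaled {β : ℝ} (hβ : klBetaMin ≤ β) {m : ℕ} (hm : m ≤ nScales β + 1) {La la : ℝ} (hLa : 0 ≤ La)
    (hla : La * klScale klE0 m ≤ la) : La ≤ 4 / 3 * la * β := by
  have hΛ : klScale klE0 m = 1 / 32 * ((4 : ℝ) ^ m)⁻¹ := by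
    rw [show klScale klE0 m = klE0 * ((4 : ℝ) ^ m)⁻¹ from rfl, klE0]
  have hY0 : (0 : ℝ) < (4 : ℝ) ^ m := by positivity
  have hY := klpl_four_pow_le_of_le_succ hβ hm
  rw [hΛ] at hla
  have h1 : La = La * (1 / 32 * ((4 : ℝ) ^ m)⁻¹) * (32 * (4 : ℝ) ^ m) := by field_simp
  have hla0 : 0 ≤ la := le_trans (by positivity) hla
  calc La = La * (1 / 32 * ((4 : ℝ) ^ m)⁻¹) * (32 * (4 : ℝ) ^ m) := h1
    _ ≤ la * (32 * (4 : ℝ) ^ m) := mul_le_mul_of_nonneg_right hla (by positivity)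
    _ ≤ la * (32 * (β / 24)) := mul_le_mul_of_nonneg_left (by linarith) hla0
    _ = 4 / 3 * la * β := by ring

/-- **THE L-ROW, OVERLAP-SLOT FORM, SCALE-FREE LIPSCHITZ DATUM**: as `klpl_lattice_row_le_overlap`, but the Lipschitz constant enters only through `L_A·Λ_m ≤ l` for SOME
`m ≤ n_β + 1` — so a global Lipschitz constant growing like `4^m` (the running pair amplitude's, cf. k3c2-p2's CELL-SIGNATURES «one global `Lg`, currency `≤ 2^30·4ⁿK²`»)
is booked with an n-FLAT coefficient: `2·LAT⋆ₙ/L ≤ (l + A₀·G·C)·U/(2^48·klEngPsq P²·klEngRsq R²)·4^{−(n+1)}`. -/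
theorem klpl_lattice_row_le_overlap_scaled {P : SplitConsts} {R : RenConsts} {β U : ℝ} (hβ : klBetaMin ≤ β) (hU : 0 < U) {L : ℕ}
    (hL : klEngL₄ P R β U ≤ L) {n : ℕ} (hn : n ≤ nScales β) {m : ℕ} (hm : m ≤ nScales β + 1) {La la A₀ G C : ℝ} (hLa : 0 ≤ La)
    (hla : La * klScale klE0 m ≤ la) (hA0 : 0 ≤ A₀) (hG : 0 ≤ G) (hC : 0 ≤ C) :
    2 * (96 * (512 * La / klScale klE0 (n + 1) + 32 * A₀ * G * C / klScale klE0 (n + 1) ^ 2) / L) ≤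
      (la + A₀ * G * C) * U / (2 ^ 48 * klEngPsq P ^ 2 * klEngRsq R ^ 2) * ((4 : ℝ) ^ (n + 1))⁻¹ := by
  have hβ0 : 0 < β := lt_of_lt_of_le (by norm_num [klBetaMin]) hβ
  have h128 : (128 : ℝ) ≤ β := by simpa [klBetaMin] using hβ
  have hLn := pos_of_klEngL₄_le hL
  have hPR0 : 0 < klEngPsq P ^ 2 * klEngRsq R ^ 2 := mul_pos (pow_pos (klEngPsq_pos P) 2) (pow_pos (klEngRsq_pos R) 2)
  set PR : ℝ := klEngPsq P ^ 2 * klEngRsq R ^ 2 with hPR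
  have h1L := klpl_one_div_le (P := P) (R := R) hβ hU hL
  rw [← hPR] at h1L
  set X : ℝ := (4 : ℝ) ^ (n + 1) with hX
  have hX0 : 0 < X := by positivity
  have hXβ : X ≤ β / 24 := klpl_four_pow_succ_le hβ hn
  have hAGC : 0 ≤ A₀ * G * C := by positivity
  have hLaβ : La ≤ 4 / 3 * la * β := klpl_lip_le_of_scaled hβ hm hLa hla
  have hla0 : 0 ≤ la := le_trans (mul_nonneg hLa (klth_klScale_pos m).le) hla
  rw [klpl_lattice_term_eq hLn]
  rw [← hX]
  have hX2 : X ^ 2 ≤ (β / 24) ^ 2 := pow_le_pow_left₀ hX0.le hXβ 2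
  have hX3 : X ^ 3 ≤ (β / 24) ^ 3 := pow_le_pow_left₀ hX0.le hXβ 3
  have hkey : 192 * (16384 * La * X + 32768 * (A₀ * G * C) * X ^ 2) / (2 ^ 61 * β ^ 3) ≤ (la + A₀ * G * C) / (2 ^ 48 * X) := by
    rw [div_le_div_iff₀ (by positivity) (by positivity)]
    have hA : La * X ^ 2 ≤ 4 / 3 * la * β * (β / 24) ^ 2 := by
      calc La * X ^ 2 ≤ La * (β / 24) ^ 2 := mul_le_mul_of_nonneg_left hX2 hLa
        _ ≤ 4 / 3 * la * β * (β / 24) ^ 2 := mul_le_mul_of_nonneg_right hLaβ (by positivity)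
    have hB : A₀ * G * C * X ^ 3 ≤ A₀ * G * C * (β / 24) ^ 3 := mul_le_mul_of_nonneg_left hX3 hAGC
    have hlaβ : 0 ≤ la * β ^ 3 := by positivity
    have hAGCβ : 0 ≤ A₀ * G * C * β ^ 3 := by positivity
    nlinarith [hA, hB, hlaβ, hAGCβ]
  have hnum0 : 0 ≤ 192 * (16384 * La * X + 32768 * (A₀ * G * C) * X ^ 2) := by positivity
  have hUPR : 0 ≤ U / PR := by positivity
  calc 192 * (16384 * La * X + 32768 * (A₀ * G * C) * X ^ 2) * (1 / (L : ℝ))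
      ≤ 192 * (16384 * La * X + 32768 * (A₀ * G * C) * X ^ 2) * (U / (2 ^ 61 * PR * β ^ 3)) := mul_le_mul_of_nonneg_left h1L hnum0
    _ = 192 * (16384 * La * X + 32768 * (A₀ * G * C) * X ^ 2) / (2 ^ 61 * β ^ 3) * (U / PR) := by
        field_simp
    _ ≤ (la + A₀ * G * C) / (2 ^ 48 * X) * (U / PR) := mul_le_mul_of_nonneg_right hkey hUPR
    _ = (la + A₀ * G * C) * U / (2 ^ 48 * klEngPsq P ^ 2 * klEngRsq R ^ 2) * X⁻¹ := by
        rw [hPR]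
        field_simp

/-- **THE L-ROW, THERMAL-SLOT FORM, SCALE-FREE LIPSCHITZ DATUM**: `2·LAT⋆ₙ/L ≤ (l + A₀·G·C)·U/(2^48·klEngPsq P²·klEngRsq R²)·4^{−(n_β−n)}` under `L_A·Λ_m ≤ l`. -/
theorem klpl_lattice_row_le_thermal_scaled {P : SplitConsts} {R : RenConsts} {β U : ℝ} (hβ : klBetaMin ≤ β) (hU : 0 < U) {L : ℕ}
    (hL : klEngL₄ P R β U ≤ L) {n : ℕ} (hn : n ≤ nScales β) {m : ℕ} (hm : m ≤ nScales β + 1) {La la A₀ G C : ℝ} (hLa : 0 ≤ La)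
    (hla : La * klScale klE0 m ≤ la) (hA0 : 0 ≤ A₀) (hG : 0 ≤ G) (hC : 0 ≤ C) :
    2 * (96 * (512 * La / klScale klE0 (n + 1) + 32 * A₀ * G * C / klScale klE0 (n + 1) ^ 2) / L) ≤
      (la + A₀ * G * C) * U / (2 ^ 48 * klEngPsq P ^ 2 * klEngRsq R ^ 2) * ((4 : ℝ) ^ (nScales β - n))⁻¹ := by
  have hβ0 : 0 < β := lt_of_lt_of_le (by norm_num [klBetaMin]) hβ
  have h128 : (128 : ℝ) ≤ β := by simpa [klBetaMin] using hβ
  have hLn := pos_of_klEngL₄_le hL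
  have hPR0 : 0 < klEngPsq P ^ 2 * klEngRsq R ^ 2 := mul_pos (pow_pos (klEngPsq_pos P) 2) (pow_pos (klEngRsq_pos R) 2)
  set PR : ℝ := klEngPsq P ^ 2 * klEngRsq R ^ 2 with hPR
  have h1L := klpl_one_div_le (P := P) (R := R) hβ hU hL
  rw [← hPR] at h1L
  set X : ℝ := (4 : ℝ) ^ (n + 1) with hX
  set W : ℝ := (4 : ℝ) ^ (nScales β - n) with hW
  have hX0 : 0 < X := by positivity
  have hW1 : 1 ≤ W := one_le_pow₀ (by norm_num)
  have hXβ : X ≤ β / 24 := klpl_four_pow_succ_le hβ hn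
  have hXW : X * W ≤ β / 24 := klpl_four_pow_succ_mul_le hβ hn
  have hAGC : 0 ≤ A₀ * G * C := by positivity
  have hLaβ : La ≤ 4 / 3 * la * β := klpl_lip_le_of_scaled hβ hm hLa hla
  have hla0 : 0 ≤ la := le_trans (mul_nonneg hLa (klth_klScale_pos m).le) hla
  rw [klpl_lattice_term_eq hLn]
  rw [← hX]
  have hkey : 192 * (16384 * La * X + 32768 * (A₀ * G * C) * X ^ 2) / (2 ^ 61 * β ^ 3) ≤ (la + A₀ * G * C) / (2 ^ 48 * W) := by
    rw [div_le_div_iff₀ (by positivity) (by positivity)]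
    have hA : La * (X * W) ≤ 4 / 3 * la * β * (β / 24) := by
      calc La * (X * W) ≤ La * (β / 24) := mul_le_mul_of_nonneg_left hXW hLa
        _ ≤ 4 / 3 * la * β * (β / 24) := mul_le_mul_of_nonneg_right hLaβ (by positivity)
    have hXXW : X * (X * W) ≤ β / 24 * (β / 24) := mul_le_mul hXβ hXW (by positivity) (by positivity)
    have hB : A₀ * G * C * (X * (X * W)) ≤ A₀ * G * C * (β / 24 * (β / 24)) := mul_le_mul_of_nonneg_left hXXW hAGC
    have hβ1 : β ^ 2 * 128 ≤ β ^ 3 := by nlinarith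
    have hA' : la * (β ^ 2 * 128) ≤ la * β ^ 3 := mul_le_mul_of_nonneg_left hβ1 hla0
    have hB' : A₀ * G * C * (β ^ 2 * 128) ≤ A₀ * G * C * β ^ 3 := mul_le_mul_of_nonneg_left hβ1 hAGC
    have hlaβ : 0 ≤ la * β ^ 3 := by positivity
    have hAGCβ : 0 ≤ A₀ * G * C * β ^ 3 := by positivity
    nlinarith [hA, hB, hA', hB', hlaβ, hAGCβ]
  have hnum0 : 0 ≤ 192 * (16384 * La * X + 32768 * (A₀ * G * C) * X ^ 2) := by positivity
  have hUPR : 0 ≤ U / PR := by positivity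
  calc 192 * (16384 * La * X + 32768 * (A₀ * G * C) * X ^ 2) * (1 / (L : ℝ))
      ≤ 192 * (16384 * La * X + 32768 * (A₀ * G * C) * X ^ 2) * (U / (2 ^ 61 * PR * β ^ 3)) := mul_le_mul_of_nonneg_left h1L hnum0
    _ = 192 * (16384 * La * X + 32768 * (A₀ * G * C) * X ^ 2) / (2 ^ 61 * β ^ 3) * (U / PR) := by
        field_simp
    _ ≤ (la + A₀ * G * C) / (2 ^ 48 * W) * (U / PR) := mul_le_mul_of_nonneg_right hkey hUPR
    _ = (la + A₀ * G * C) * U / (2 ^ 48 * klEngPsq P ^ 2 * klEngRsq R ^ 2) * W⁻¹ := by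
        rw [hPR]
        field_simp

end LRowScaled

variable {L M : ℕ} [NeZero L] [NeZero M] (β μ : ℝ) (K : TrigPolyC4v)

section AdapterTCL

variable {a' b' : ℝ} (B : BandBounds a' b') {R : RenConsts} {U : ℝ} {N : ℕ} {A : ℝ}

/-! ## §1 The pinned pair's five-slot rows with the L-ROW (TC family, any transfer in the window) -/

set_option maxHeartbeats 1600000 in
/-- **THE PINNED PAIR's DIRECT `D`-ROW IN FIVE-SLOT FORM, WITH THE L-ROW** (TC family; module docstring): the conclusion of `dLine_pinned_direct_fiveSlotTC'`
verbatim; hypotheses = its binders + `0 < U`, `klEngL₄ P R β U ≤ L`; the lattice entry now sits in `hz` (overlap slot, coefficient `(L₁ + A₀GC)·U/(2^52 Psq²Rsq²)`),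
`hl` keeps the window's `L`-part only. -/
theorem dLine_pinned_direct_fiveSlotTCL (hR : ∀ j, 0 ≤ R.Gfr j) (hK : FrameOK R U N μ K)
    (hAb : ∀ p : Momentum, ∀ j ≤ 2, ‖iteratedFDeriv ℝ j (frameShift K) p‖ ≤ A) (hA : 4 * A < B.Dtmin) (hA20 : 4 * A ≤ 1 / 20) (hμ : μ ≤ -0.15)
    (n : ℕ) {t : ℝ} (ht : t ∈ Icc (0 : ℝ) 1) (hβ : klBetaMin ≤ β) (hβL : β ≤ L) (hn : n + 1 ≤ nScales β + 1)
    (hM : β * (4 * klScale klE0 (n + 1)) / (2 * Real.pi) + 1 ≤ M)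
    (Wd : ℝ → FreqMomentum L M → ℝ) (hWd : Wd = fun t k => deriv (fun Λ' : ℝ => hubbardCutoffWeightCT L M β μ K Λ' k) (klScale klE0 n + t * (klScale klE0 (n + 1) - klScale klE0 n)))
    (V : ℕ → ℝ → (Fin 4 → HubbardFieldIdx L M) → ℂ) {j : ℕ} (hj : n + 2 ≤ j) (Qm x y : TorusSite 2 L)
    (hlo : a' < μ - 4 * klScale klE0 (n + 1) - 4 * A) (hhi : μ + 4 * klScale klE0 (n + 1) + 4 * A < b')
    (hq : (4 + 8 / 3 * R.Gfr 1 * U ^ 2) * klTorusNorm L (x - y) ≤ klScale klE0 (n + 1) / 8)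
    (c : ℂ) (F₁ F₂ : FreqMomentum L M → Fin 2 → FreqMomentum L M → ℂ) (F₁₀ : TorusSite 2 L → Fin 2 → TorusSite 2 L → ℂ)
    (hsplit : ∀ (p : FreqMomentum L M) (σ : Fin 2) (p' : FreqMomentum L M),
      V j t ![((p, σ), 1), ((p', σ), 0), (((omega0 M, y), 0), 0), (((omega0 M, x), 0), 1)] *
          V j t ![((p, σ), 0), ((p', σ), 1), ((((omega0 M).rev, Qm - y), 1), 0), ((((omega0 M).rev, Qm - x), 1), 1)] = c + F₁ p σ p' + F₂ p σ p')
    {A₁ L₁ ε₁ : ℝ} (hA1 : 0 ≤ A₁) (hL1 : 0 ≤ L₁) (hε1 : 0 ≤ ε₁)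
    (hY0p₁ : ∀ k : TorusSite 2 L, ‖∑ σ : Fin 2, F₁₀ k σ (k + (x - y))‖ ≤ A₁)
    (hY1p₁ : ∀ k k' : TorusSite 2 L, ‖(∑ σ : Fin 2, F₁₀ k σ (k + (x - y))) - ∑ σ : Fin 2, F₁₀ k' σ (k' + (x - y))‖ ≤ L₁ * klTorusNorm L (k - k'))
    (hY0m₁ : ∀ k : TorusSite 2 L, ‖∑ σ : Fin 2, F₁₀ (k + -(x - y)) σ k‖ ≤ A₁)
    (hY1m₁ : ∀ k k' : TorusSite 2 L, ‖(∑ σ : Fin 2, F₁₀ (k + -(x - y)) σ k) - ∑ σ : Fin 2, F₁₀ (k' + -(x - y)) σ k'‖ ≤ L₁ * klTorusNorm L (k - k'))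
    (hflat₁ : ∀ (i : MatsubaraIdx M) (σ : Fin 2) (k k' : TorusSite 2 L), matsubaraFreq β M i ^ 2 ≤ (4 * klScale klE0 (n + 1)) ^ 2 →
      ‖F₁ (i, k) σ (i, k') - F₁₀ k σ k'‖ ≤ ε₁)
    (cen : TorusSite 2 L) {ρ A₂ : ℝ} (hρ : 0 ≤ ρ) (hA2 : 0 ≤ A₂)
    (hF₂ : ∀ (p : FreqMomentum L M) (σ : Fin 2) (p' : FreqMomentum L M), ‖F₂ p σ p'‖ ≤ A₂)
    (hsupp₂ : ∀ (p : FreqMomentum L M) (σ : Fin 2) (p' : FreqMomentum L M), ρ < klTorusNorm L (p.2 - cen) → F₂ p σ p' = 0)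
    {P : SplitConsts} {zD hD wD lD tD : ℝ} (hU : 0 < U) (hL : klEngL₄ P R β U ≤ L)
    (hz : 3 / π * (64 / Real.pi * 8 * (Real.pi * Real.sqrt 2 / (B.Dtmin - 4 * A) * (2 * L₁ + 2 * (2 * ‖c‖ + A₁) * (2 / (1 / 10))) / (B.Dtmin - 4 * A) + 2 * (2 * ‖c‖ + A₁) * (1 / (B.Dtmin - 4 * A) ^ 2 + Real.pi * Real.sqrt 2 * (2 + 4 * A) / (B.Dtmin - 4 * A) ^ 3))) *
          klE0 * ((4 : ℝ) ^ (n + 1))⁻¹ + A₂ * (1024 * 15381) * (ρ / π) +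
          (L₁ + (2 * ‖c‖ + A₁) * (4 + 8 / 3 * R.Gfr 1 * U ^ 2) * ((9 * (2 * (448 / 3 * Real.exp 2) + 8) + 4 * 8) + (3 * (8 * (16 : ℝ)) + 512 * 1))) * U / (2 ^ 52 * klEngPsq P ^ 2 * klEngRsq R ^ 2) * ((4 : ℝ) ^ (n + 1))⁻¹ ≤
        (P.Klam * U) ^ 2 * zD * ((4 : ℝ) ^ (n + 1))⁻¹)
    (hh : 12 / π * ((393216 / Real.pi * (64 * 16 + (2 * (448 / 3 * Real.exp 2) + 8) + 64) * (2 * (2 * ‖c‖ + A₁) * (Real.pi * Real.sqrt 2 / (B.Dtmin - 4 * A)))) + (48 / Real.pi * 8 * (2 * (2 * ‖c‖ + A₁) * (Real.pi * Real.sqrt 2 / (B.Dtmin - 4 * A))) * (3 * (8 * (16 : ℝ)) + 512 * 1)) * (4 + 8 / 3 * R.Gfr 1 * U ^ 2)) *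
          ((4 : ℝ) ^ (nScales β - n))⁻¹ ≤ (P.Klam * U) ^ 2 * hD * ((4 : ℝ) ^ (nScales β - n))⁻¹)
    (hw : ε₁ * (512 * 15367) ≤ (P.Klam * U) ^ 2 * wD * ((2 : ℝ) ^ n)⁻¹)
    (hl : A₂ * (1024 * 15381) ≤ (P.Klam * U) ^ 2 * lD)
    (htt : 3 / π * (64 / Real.pi * 8 * (2 * (2 * ‖c‖ + A₁) * (Real.pi * Real.sqrt 2 / (B.Dtmin - 4 * A))) * (3 * (8 * (16 : ℝ)) + 512 * 1)) *
          ((4 + 8 / 3 * R.Gfr 1 * U ^ 2) * min (klTorusNorm L (x - y) / klScale klE0 (n + 1)) (klScale klE0 (n + 1) / klTorusNorm L (x - y))) ≤ (P.Klam * U) ^ 2 * tD * min (klTorusNorm L (x - y) / klScale klE0 (n + 1)) (klScale klE0 (n + 1) / klTorusNorm L (x - y))) :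
    (klScale klE0 n - klScale klE0 (n + 1)) * ((β * (L : ℝ) ^ 2) ^ 3)⁻¹ *
        ‖∑ p : FreqMomentum L M, ∑ σ : Fin 2, ∑ p' : FreqMomentum L M,
          if matsubaraInt M p'.1 + matsubaraInt M (omega0 M) = matsubaraInt M p.1 + matsubaraInt M (omega0 M) ∧ p'.2 = p.2 + x - y then
            ((((((softSymbolCompl L M β μ K (n + 1) j p - softSymbolCompl L M β μ K (n + 1) (n + 1) p) : ℝ) : ℂ) * (((β * (L : ℝ) ^ 2 : ℝ) : ℂ) * propCT L M β μ K p)) *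
                  ((((Wd t p') : ℝ) : ℂ) * (((β * (L : ℝ) ^ 2 : ℝ) : ℂ) * propCT L M β μ K p'))) +
                (((((Wd t p) : ℝ) : ℂ) * (((β * (L : ℝ) ^ 2 : ℝ) : ℂ) * propCT L M β μ K p)) *
                  ((((softSymbolCompl L M β μ K (n + 1) j p' - softSymbolCompl L M β μ K (n + 1) (n + 1) p') : ℝ) : ℂ) * (((β * (L : ℝ) ^ 2 : ℝ) : ℂ) * propCT L M β μ K p')))) *
              (V j t ![((p, σ), 1), ((p', σ), 0), (((omega0 M, y), 0), 0), (((omega0 M, x), 0), 1)] *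
                V j t ![((p, σ), 0), ((p', σ), 1), ((((omega0 M).rev, Qm - y), 1), 0), ((((omega0 M).rev, Qm - x), 1), 1)])
          else 0‖ ≤
      (P.Klam * U) ^ 2 * (zD * ((4 : ℝ) ^ (n + 1))⁻¹ + hD * ((4 : ℝ) ^ (nScales β - n))⁻¹ + wD * ((2 : ℝ) ^ n)⁻¹ + lD * ((L : ℝ))⁻¹ + tD * min (klTorusNorm L (x - y) / klScale klE0 (n + 1)) (klScale klE0 (n + 1) / klTorusNorm L (x - y))) := by
  have hβ0 : 0 < β := lt_of_lt_of_le (by norm_num [klBetaMin]) hβ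
  have hdoor := dLine_pinned_direct_split3_doorTC β μ K B hR hK hAb hA hA20 hμ n ht hβ hβL hn hM Wd hWd V hj Qm x y hlo hhi hq c F₁ F₂ F₁₀ hsplit
    hA1 hL1 hε1 hY0p₁ hY1p₁ hY0m₁ hY1m₁ hflat₁ cen hρ hA2 hF₂ hsupp₂
  rw [klpp_rowTC_two_add, zero_add] at hdoor
  have hr0 : 0 ≤ klTorusNorm L (x - y) := torusSupNorm_nonneg _
  have hA0 : 0 ≤ A := (norm_nonneg _).trans (hAb 0 0 (by norm_num))
  have hdA : 0 < B.Dtmin - 4 * A := by linarith only [hA]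
  have hnβ : n ≤ nScales β := by omega
  have hGfr : 0 ≤ R.Gfr 1 := hR 1
  have hG4 : 4 ≤ (4 + 8 / 3 * R.Gfr 1 * U ^ 2) := by nlinarith [sq_nonneg U]
  have hrΛ : klTorusNorm L (x - y) ≤ klScale klE0 (n + 1) := by
    have h4 := mul_le_mul_of_nonneg_right hG4 hr0
    linarith only [hq, h4, klth_klScale_pos (n + 1)]
  have hG0 : 0 ≤ (4 + 8 / 3 * R.Gfr 1 * U ^ 2) := by nlinarith [sq_nonneg U]
  have hslots := pinned_row_le_slotsTC₀ (L := L) (β := β) (G := (4 + 8 / 3 * R.Gfr 1 * U ^ 2)) hdA hA0 hG0 (by positivity : (0 : ℝ) ≤ 2 * ‖c‖ + A₁) hL1 hβ hnβ hr0 hrΛ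
  have hC0 : (0 : ℝ) ≤ ((9 * (2 * (448 / 3 * Real.exp 2) + 8) + 4 * 8) + (3 * (8 * (16 : ℝ)) + 512 * 1)) := by positivity
  have hG0' : (0 : ℝ) ≤ (4 + 8 / 3 * R.Gfr 1 * U ^ 2) := by nlinarith [sq_nonneg U]
  have hlat := klpl_lattice_row_le_overlap (P := P) (R := R) hβ hU hL hnβ hL1 (by positivity : (0 : ℝ) ≤ (2 * ‖c‖ + A₁)) hG0' hC0
  have hLpos : (0 : ℝ) < L := by exact_mod_cast pos_of_klEngL₄_le hL
  have hlL : A₂ * (1024 * 15381) * ((L : ℝ))⁻¹ ≤ (P.Klam * U) ^ 2 * lD * ((L : ℝ))⁻¹ := mul_le_mul_of_nonneg_right hl (inv_nonneg.mpr hLpos.le)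
  have e5 : (P.Klam * U) ^ 2 * (zD * ((4 : ℝ) ^ (n + 1))⁻¹ + hD * ((4 : ℝ) ^ (nScales β - n))⁻¹ + wD * ((2 : ℝ) ^ n)⁻¹ + lD * ((L : ℝ))⁻¹ + tD * min (klTorusNorm L (x - y) / klScale klE0 (n + 1)) (klScale klE0 (n + 1) / klTorusNorm L (x - y))) =
      (P.Klam * U) ^ 2 * zD * ((4 : ℝ) ^ (n + 1))⁻¹ + (P.Klam * U) ^ 2 * hD * ((4 : ℝ) ^ (nScales β - n))⁻¹ + (P.Klam * U) ^ 2 * wD * ((2 : ℝ) ^ n)⁻¹ +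
        (P.Klam * U) ^ 2 * lD * ((L : ℝ))⁻¹ + (P.Klam * U) ^ 2 * tD * min (klTorusNorm L (x - y) / klScale klE0 (n + 1)) (klScale klE0 (n + 1) / klTorusNorm L (x - y)) := by ring
  rw [e5]
  have eW : A₂ * (1024 * 15381) * (ρ / π + ((L : ℝ))⁻¹) = A₂ * (1024 * 15381) * (ρ / π) + A₂ * (1024 * 15381) * ((L : ℝ))⁻¹ := by ring
  linarith only [hdoor, hslots, hz, hh, hw, hlL, hlat, htt, eW]

set_option maxHeartbeats 1600000 in
/-- **THE PINNED PAIR's CROSSED `D`-ROW IN FIVE-SLOT FORM, WITH THE L-ROW** (TC family; module docstring): the conclusion of `dLine_pinned_crossed_fiveSlotTC'`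
verbatim; hypotheses = its binders + `0 < U`, `klEngL₄ P R β U ≤ L`; lattice entry in `hz`, `hl` = the window's `L`-part only. -/
theorem dLine_pinned_crossed_fiveSlotTCL (hR : ∀ j, 0 ≤ R.Gfr j) (hK : FrameOK R U N μ K)
    (hAb : ∀ p : Momentum, ∀ j ≤ 2, ‖iteratedFDeriv ℝ j (frameShift K) p‖ ≤ A) (hA : 4 * A < B.Dtmin) (hA20 : 4 * A ≤ 1 / 20) (hμ : μ ≤ -0.15)
    (n : ℕ) {t : ℝ} (ht : t ∈ Icc (0 : ℝ) 1) (hβ : klBetaMin ≤ β) (hβL : β ≤ L) (hn : n + 1 ≤ nScales β + 1) (hβn : 16 * π / β ≤ klScale klE0 (n + 1))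
    (hM : β * (4 * klScale klE0 (n + 1)) / (2 * Real.pi) + 1 ≤ M)
    (Wd : ℝ → FreqMomentum L M → ℝ) (hWd : Wd = fun t k => deriv (fun Λ' : ℝ => hubbardCutoffWeightCT L M β μ K Λ' k) (klScale klE0 n + t * (klScale klE0 (n + 1) - klScale klE0 n)))
    (V : ℕ → ℝ → (Fin 4 → HubbardFieldIdx L M) → ℂ) {j : ℕ} (hj : n + 2 ≤ j) (Qm x y : TorusSite 2 L)
    (hlo : a' < μ - 4 * klScale klE0 (n + 1) - 4 * A) (hhi : μ + 4 * klScale klE0 (n + 1) + 4 * A < b')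
    (hq : (4 + 8 / 3 * R.Gfr 1 * U ^ 2) * klTorusNorm L (Qm - x - y) ≤ klScale klE0 (n + 1) / 16)
    (c : ℂ) (F₁ F₂ : FreqMomentum L M → FreqMomentum L M → ℂ) (F₁₀ : TorusSite 2 L → TorusSite 2 L → ℂ)
    (hsplit : ∀ (p p' : FreqMomentum L M),
      V j t ![((p, 0), 1), ((p', 1), 0), (((omega0 M, y), 0), 0), ((((omega0 M).rev, Qm - x), 1), 1)] *
          V j t ![((p, 0), 0), ((p', 1), 1), ((((omega0 M).rev, Qm - y), 1), 0), (((omega0 M, x), 0), 1)] = c + F₁ p p' + F₂ p p')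
    {A₁ L₁ ε₁ : ℝ} (hA1 : 0 ≤ A₁) (hL1 : 0 ≤ L₁) (hε1 : 0 ≤ ε₁)
    (hY0B₁ : ∀ k : TorusSite 2 L, ‖F₁₀ k (k + (Qm - x - y))‖ ≤ A₁)
    (hY1B₁ : ∀ k k' : TorusSite 2 L, ‖F₁₀ k (k + (Qm - x - y)) - F₁₀ k' (k' + (Qm - x - y))‖ ≤ L₁ * klTorusNorm L (k - k'))
    (hY0A₁ : ∀ k : TorusSite 2 L, ‖F₁₀ (k + -(Qm - x - y)) k‖ ≤ A₁)
    (hY1A₁ : ∀ k k' : TorusSite 2 L, ‖F₁₀ (k + -(Qm - x - y)) k - F₁₀ (k' + -(Qm - x - y)) k'‖ ≤ L₁ * klTorusNorm L (k - k'))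
    (hflat₁ : ∀ (i i' : MatsubaraIdx M) (k k' : TorusSite 2 L), matsubaraInt M i' + 1 = matsubaraInt M i →
      matsubaraFreq β M i ^ 2 ≤ (5 * klScale klE0 (n + 1)) ^ 2 → ‖F₁ (i, k) (i', k') - F₁₀ k k'‖ ≤ ε₁)
    (cen : TorusSite 2 L) {ρ A₂ : ℝ} (hρ : 0 ≤ ρ) (hA2 : 0 ≤ A₂)
    (hF₂ : ∀ (p p' : FreqMomentum L M), ‖F₂ p p'‖ ≤ A₂)
    (hsupp₂ : ∀ (p p' : FreqMomentum L M), ρ < klTorusNorm L (p.2 - cen) → F₂ p p' = 0)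
    {P : SplitConsts} {zX hX wX lX tX : ℝ} (hU : 0 < U) (hL : klEngL₄ P R β U ≤ L)
    (hz : 3 / π * (64 / Real.pi * 8 * (Real.pi * Real.sqrt 2 / (B.Dtmin - 4 * A) * (2 * L₁ + 2 * (‖c‖ + A₁) * (2 / (1 / 10))) / (B.Dtmin - 4 * A) + 2 * (‖c‖ + A₁) * (1 / (B.Dtmin - 4 * A) ^ 2 + Real.pi * Real.sqrt 2 * (2 + 4 * A) / (B.Dtmin - 4 * A) ^ 3))) *
          klE0 * ((4 : ℝ) ^ (n + 1))⁻¹ + A₂ * (1024 * 15381) * (ρ / π) +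
          (L₁ + (‖c‖ + A₁) * (4 + 8 / 3 * R.Gfr 1 * U ^ 2) * ((9 * (2 * (448 / 3 * Real.exp 2) + 8) + 4 * 8) + (3 * (8 * (16 : ℝ)) + 512 * 1))) * U / (2 ^ 52 * klEngPsq P ^ 2 * klEngRsq R ^ 2) * ((4 : ℝ) ^ (n + 1))⁻¹ ≤
        (P.Klam * U) ^ 2 * zX * ((4 : ℝ) ^ (n + 1))⁻¹)
    (hh : 12 / π * ((393216 / Real.pi * (64 * 16 + (2 * (448 / 3 * Real.exp 2) + 8) + 64) * (2 * (‖c‖ + A₁) * (Real.pi * Real.sqrt 2 / (B.Dtmin - 4 * A)))) + 2 * (64 / Real.pi * 8 * (2 * (‖c‖ + A₁) * (Real.pi * Real.sqrt 2 / (B.Dtmin - 4 * A))) * (3 * (8 * (16 : ℝ)) + 512 * 1)) + 8 * (48 / Real.pi * 8 * (2 * (‖c‖ + A₁) * (Real.pi * Real.sqrt 2 / (B.Dtmin - 4 * A))) * (3 * (8 * (16 : ℝ)) + 512 * 1)) + (48 / Real.pi * 8 * (2 * (‖c‖ + A₁) * (Real.pi * Real.sqrt 2 / (B.Dtmin - 4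 * A))) * (3 * (8 * (16 : ℝ)) + 512 * 1)) * (4 + 8 / 3 * R.Gfr 1 * U ^ 2)) *
          ((4 : ℝ) ^ (nScales β - n))⁻¹ ≤ (P.Klam * U) ^ 2 * hX * ((4 : ℝ) ^ (nScales β - n))⁻¹)
    (hw : ε₁ * (512 * 15367) ≤ (P.Klam * U) ^ 2 * wX * ((2 : ℝ) ^ n)⁻¹)
    (hl : A₂ * (1024 * 15381) ≤ (P.Klam * U) ^ 2 * lX)
    (htt : 3 / π * (64 / Real.pi * 8 * (2 * (‖c‖ + A₁) * (Real.pi * Real.sqrt 2 / (B.Dtmin - 4 * A))) * (3 * (8 * (16 : ℝ)) + 512 * 1)) *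
          ((4 + 8 / 3 * R.Gfr 1 * U ^ 2) * min (klTorusNorm L (Qm - x - y) / klScale klE0 (n + 1)) (klScale klE0 (n + 1) / klTorusNorm L (Qm - x - y))) ≤ (P.Klam * U) ^ 2 * tX * min (klTorusNorm L (Qm - x - y) / klScale klE0 (n + 1)) (klScale klE0 (n + 1) / klTorusNorm L (Qm - x - y))) :
    (klScale klE0 n - klScale klE0 (n + 1)) * ((β * (L : ℝ) ^ 2) ^ 3)⁻¹ *
        ‖∑ p : FreqMomentum L M, ∑ p' : FreqMomentum L M,
          if matsubaraInt M p'.1 + matsubaraInt M (omega0 M) + matsubaraInt M (omega0 M) + 1 = matsubaraInt M p.1 ∧ p'.2 = p.2 + Qm - x - y then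
            ((((((softSymbolCompl L M β μ K (n + 1) j p - softSymbolCompl L M β μ K (n + 1) (n + 1) p) : ℝ) : ℂ) * (((β * (L : ℝ) ^ 2 : ℝ) : ℂ) * propCT L M β μ K p)) *
                  ((((Wd t p') : ℝ) : ℂ) * (((β * (L : ℝ) ^ 2 : ℝ) : ℂ) * propCT L M β μ K p'))) +
                (((((Wd t p) : ℝ) : ℂ) * (((β * (L : ℝ) ^ 2 : ℝ) : ℂ) * propCT L M β μ K p)) *
                  ((((softSymbolCompl L M β μ K (n + 1) j p' - softSymbolCompl L M β μ K (n + 1) (n + 1) p') : ℝ) : ℂ) * (((β * (L : ℝ) ^ 2 : ℝ) : ℂ) * propCT L M β μ K p')))) *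
              (V j t ![((p, 0), 1), ((p', 1), 0), (((omega0 M, y), 0), 0), ((((omega0 M).rev, Qm - x), 1), 1)] *
                V j t ![((p, 0), 0), ((p', 1), 1), ((((omega0 M).rev, Qm - y), 1), 0), (((omega0 M, x), 0), 1)])
          else 0‖ ≤
      (P.Klam * U) ^ 2 * (zX * ((4 : ℝ) ^ (n + 1))⁻¹ + hX * ((4 : ℝ) ^ (nScales β - n))⁻¹ + wX * ((2 : ℝ) ^ n)⁻¹ + lX * ((L : ℝ))⁻¹ + tX * min (klTorusNorm L (Qm - x - y) / klScale klE0 (n + 1)) (klScale klE0 (n + 1) / klTorusNorm L (Qm - x - y))) := by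
  have hβ0 : 0 < β := lt_of_lt_of_le (by norm_num [klBetaMin]) hβ
  have hdoor := dLine_pinned_crossed_split3_doorTC β μ K B hR hK hAb hA hA20 hμ n ht hβ hβL hn hβn hM Wd hWd V hj Qm x y hlo hhi hq c F₁ F₂ F₁₀ hsplit
    hA1 hL1 hε1 hY0B₁ hY1B₁ hY0A₁ hY1A₁ hflat₁ cen hρ hA2 hF₂ hsupp₂
  rw [klpp_rowTC_four_add, zero_add] at hdoor
  have hr0 : 0 ≤ klTorusNorm L (Qm - x - y) := torusSupNorm_nonneg _
  have hA0 : 0 ≤ A := (norm_nonneg _).trans (hAb 0 0 (by norm_num))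
  have hdA : 0 < B.Dtmin - 4 * A := by linarith only [hA]
  have hnβ : n ≤ nScales β := by omega
  have hGfr : 0 ≤ R.Gfr 1 := hR 1
  have hG0 : 0 ≤ (4 + 8 / 3 * R.Gfr 1 * U ^ 2) := by nlinarith [sq_nonneg U]
  have hG4 : 4 ≤ (4 + 8 / 3 * R.Gfr 1 * U ^ 2) := by nlinarith [sq_nonneg U]
  have hrΛ : klTorusNorm L (Qm - x - y) ≤ klScale klE0 (n + 1) := by
    have h4 := mul_le_mul_of_nonneg_right hG4 hr0
    linarith only [hq, h4, klth_klScale_pos (n + 1)]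
  have hsm : |-(2 * π / β)| = 2 * π / β := by rw [abs_neg, abs_of_pos (by positivity)]
  have hsp : |2 * π / β| = 2 * π / β := abs_of_pos (by positivity)
  have hA0' : (0 : ℝ) ≤ ‖c‖ + A₁ := by positivity
  have h1m := pinned_row_le_slots_shiftTC₀ (L := L) (β := β) (G := (4 + 8 / 3 * R.Gfr 1 * U ^ 2)) hdA hA0 hG0 hA0' hL1 hβ hnβ hr0 hrΛ hsm
  have h1p := pinned_row_le_slots_shiftTC₀ (L := L) (β := β) (G := (4 + 8 / 3 * R.Gfr 1 * U ^ 2)) hdA hA0 hG0 hA0' hL1 hβ hnβ hr0 hrΛ hsp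
  have hC0 : (0 : ℝ) ≤ ((9 * (2 * (448 / 3 * Real.exp 2) + 8) + 4 * 8) + (3 * (8 * (16 : ℝ)) + 512 * 1)) := by positivity
  have hG0' : (0 : ℝ) ≤ (4 + 8 / 3 * R.Gfr 1 * U ^ 2) := by nlinarith [sq_nonneg U]
  have hlat := klpl_lattice_row_le_overlap (P := P) (R := R) hβ hU hL hnβ hL1 (by positivity : (0 : ℝ) ≤ (‖c‖ + A₁)) hG0' hC0
  have hLpos : (0 : ℝ) < L := by exact_mod_cast pos_of_klEngL₄_le hL
  have hlL : A₂ * (1024 * 15381) * ((L : ℝ))⁻¹ ≤ (P.Klam * U) ^ 2 * lX * ((L : ℝ))⁻¹ := mul_le_mul_of_nonneg_right hl (inv_nonneg.mpr hLpos.le)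
  have e5 : (P.Klam * U) ^ 2 * (zX * ((4 : ℝ) ^ (n + 1))⁻¹ + hX * ((4 : ℝ) ^ (nScales β - n))⁻¹ + wX * ((2 : ℝ) ^ n)⁻¹ + lX * ((L : ℝ))⁻¹ + tX * min (klTorusNorm L (Qm - x - y) / klScale klE0 (n + 1)) (klScale klE0 (n + 1) / klTorusNorm L (Qm - x - y))) =
      (P.Klam * U) ^ 2 * zX * ((4 : ℝ) ^ (n + 1))⁻¹ + (P.Klam * U) ^ 2 * hX * ((4 : ℝ) ^ (nScales β - n))⁻¹ + (P.Klam * U) ^ 2 * wX * ((2 : ℝ) ^ n)⁻¹ +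
        (P.Klam * U) ^ 2 * lX * ((L : ℝ))⁻¹ + (P.Klam * U) ^ 2 * tX * min (klTorusNorm L (Qm - x - y) / klScale klE0 (n + 1)) (klScale klE0 (n + 1) / klTorusNorm L (Qm - x - y)) := by ring
  rw [e5]
  have eW : A₂ * (1024 * 15381) * (ρ / π + ((L : ℝ))⁻¹) = A₂ * (1024 * 15381) * (ρ / π) + A₂ * (1024 * 15381) * ((L : ℝ))⁻¹ := by ring
  linarith only [hdoor, h1m, h1p, hz, hh, hw, hlL, hlat, htt, eW]

end AdapterTCL

end Summit.HubbardSuperconductivity.HubbardSuperconductivity.Theorems.KLRegimeSplit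

end
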